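import Literature.Computability.AlgebraicComplexity.AsymptoticSpectrumDuality
import Literature.Computability.AlgebraicComplexity.DegenerationSpectralMonotone
import Literature.Computability.AlgebraicComplexity.MatMulMonomialSubrankAsymptotics
import Literature.Computability.AlgebraicComplexity.AsymptoticRankMatMul
import Literature.Computability.AlgebraicComplexity.SchoenhageTauDischarge
import Literature.Computability.AlgebraicComplexity.TensorRestrictionRank
import Literature.Computability.AlgebraicComplexity.BorderRankCW
import Literature.Computability.AlgebraicComplexity.AlmanLi2026IteratedCW
import Summits.MatrixMultiplication.MatrixMultiplication.Theorems.SoloInformedSliceCalculus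
import Mathlib.Analysis.SpecialFunctions.Log.Base

/-!
# `R̃(cw₂) ≤ 3.9235` from the Alman–Li iterated speedup identity (evaluation at `n = 3`; `n = 4` reproduced)

Soloist file (summit-directed ideation tier, informed mode), door D1 of the summit
(`omega_le_two_of_cw_two`: `R̃(cw₂) = 3 ⟹ ω = 2`), upper half: how far below `4` the asymptotic rank of
the little Coppersmith–Winograd tensor `cw₂ = cwTensor ℂ 2` is known to be.

Alman–Li (arXiv:2605.21738, Thm. 1.3, Table 1) prove `R̃(cw₂) ≤ 3.931` by evaluating their iterated
speedup identity (§7.1 = Theorem 6.2 applied to Proposition 7.1; the named fact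
`AlmanLi2026_iteratedSpeedup_cw`) at `n = 4` — the exponent `n^{(Cor. 7.1)}` minimising the UN-iterated
bound `γ_{2,n}`. From the identity alone, via the scalar form proved in `SoloInformedSliceCalculus.lean`
(`pow_spectralPoint_cwTensor_two_le_of_iteratedSpeedup`: Strassen calculus in the kernel), this file proves

* `asymptoticRank_cwTensor_two_le_of_iteratedSpeedup` — the SAME identity at `n = 3` gives
  **`R̃(cw₂) ≤ 3.9235`** (exact value of the bound: the cube root of
  `√(68² − 1782^{2/3} + 18^{4/3}) − 18^{2/3} = 60.39380…`, i.e. `3.923413…`), better than the printed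
  `3.931`;
* `asymptoticRank_cwTensor_two_le_of_iteratedSpeedup_four` — at `n = 4` the paper's value `3.9309`
  (`238.7565…^{1/4} = 3.930871…`; reproduction of Table 1, `γ'_2`; the maximising `θ` is `2/3`, as the
  paper reports).

The numerics (`iteratedSpeedup_numeric_three` / `_four`): with `θ = log₂ g(2) ∈ [2/3, 1]`, `g(2^k) = (2^k)^θ`
exactly and `m^θ ≤ g(m)` (`rpow_logb_le_of_powLaw`); rational certificates `8^θ ∈ [4,8]`,
`18^θ ≥ 1.717·8^θ` (`1.717³ ≤ (9/4)²`), `1782^θ ≥ 36.74·8^θ` (`36.74³ ≤ (891/4)²`), resp.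
`16^θ ∈ [6.3496,16]`, `110^θ ≥ 3.615·16^θ`, `25222^θ ≥ 135.44·16^θ`, and a concave quadratic in `8^θ`
(resp. `16^θ`) closed by `nlinarith`. Strassen duality (tree, proved:
`strassen_duality_asymptoticRank_holds`) converts the pointwise bound into the bound on
`asymptoticRank (cwTensor ℂ 2)`.

Trust base: Lean, Mathlib, the tree, and the hypothesis `hAL : AlmanLi2026_iteratedSpeedup_cw` (the
printed identity). Summit relevance, honestly: door D1 needs `R̃(cw₂) = 3`; this method's ceiling is about
`3.90` (even a hypothetical slack `s = 1` at `n = 3` would give `3.897`), so this is a frontier rung of the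
door, not a path to it; no consequence for `ω`.

References: J. Alman, B. Li, *Asymptotic Rank Speedup Theorems, Revisited*, arXiv:2605.21738 (2026),
Thm. 1.3, Thm. 6.2, §7.1, Table 1 [AlmanLi2026].
-/

noncomputable section

open scoped BigOperators

namespace Summit.MatrixMultiplication.MatrixMultiplication.Theorems

open Literature.Computability.AlgebraicComplexity

/-! ## The one-variable maximisations -/

section Real

/-- **The `n = 3` evaluation of the iterated Alman–Li bound.** If `g` is a power law as above with
`g 2 ≤ 2` and `(g 2)^3 ≥ 4` (i.e. `θ ∈ [2/3, 1]`), and `X ≥ 0` satisfies the spectral form of the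
iterated identity at `q = 2`, `n = 3` — `X² + 2 X g(18) + g(1782) ≤ (64 + g 8)²` — then
`X ≤ 3.9235³` (the exact supremum is `√(68² − 1782^{2/3} + 18^{4/3}) − 18^{2/3} = 60.39380…`,
cube root `3.923413…`). Certificates: `8^θ ∈ [4,8]`, `18^θ ≥ 1.717·8^θ` (`1.717³ ≤ (9/4)²`),
`1782^θ ≥ 36.74·8^θ` (`36.74³ ≤ (891/4)²`), and a concave quadratic in `8^θ`. -/
theorem iteratedSpeedup_numeric_three {g : ℕ → ℝ} (hg0 : ∀ m, 0 ≤ g m)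
    (hpow : ∀ a L : ℕ, g (a ^ L) = g a ^ L) (hmono : ∀ a b : ℕ, a ≤ b → g a ≤ g b)
    (h2 : g 2 ≤ 2) (h4 : 4 ≤ g 2 ^ 3) {X : ℝ}
    (hid : X ^ 2 + 2 * X * g 18 + g 1782 ≤ (4 ^ 3 + g 8) ^ 2) : X ≤ 3.9235 ^ 3 := by
  have hg2 := hg0 2
  have hsq : g 2 ^ 2 ≤ 4 := by nlinarith
  have h1 : 1 ≤ g 2 := by nlinarith
  set θ := Real.logb 2 (g 2) with hθ
  have hc : (2 : ℝ) ^ θ = g 2 := Real.rpow_logb (by norm_num) (by norm_num) (by linarith)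
  have pw : ∀ j : ℕ, ((2 : ℝ) ^ j) ^ θ = g 2 ^ j := fun j => by
    rw [← Real.rpow_natCast (2 : ℝ) j, ← Real.rpow_mul (by norm_num : (0:ℝ) ≤ 2), mul_comm,
      Real.rpow_mul (by norm_num : (0:ℝ) ≤ 2), hc, Real.rpow_natCast]
  -- θ ∈ [2/3, 1]
  have hθ23 : 2 / 3 ≤ θ := by
    have h : (2 : ℝ) ^ (2 : ℝ) ≤ (2 : ℝ) ^ (θ * 3) := by
      rw [Real.rpow_mul (by norm_num : (0:ℝ) ≤ 2), hc, Real.rpow_two,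
        show (3 : ℝ) = ((3 : ℕ) : ℝ) by norm_num, Real.rpow_natCast]
      linarith
    have := (Real.rpow_le_rpow_left_iff one_lt_two).1 h
    linarith
  have hθ1 : θ ≤ 1 := by
    have h : (2 : ℝ) ^ θ ≤ (2 : ℝ) ^ (1 : ℝ) := by rw [hc, Real.rpow_one]; exact h2
    exact (Real.rpow_le_rpow_left_iff one_lt_two).1 h
  -- the four values
  have h8 : g 8 = (8 : ℝ) ^ θ := by
    rw [show (8 : ℕ) = 2 ^ 3 by norm_num, hpow, ← pw 3]; norm_num
  have h18 : (18 : ℝ) ^ θ ≤ g 18 := by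
    have := rpow_logb_le_of_powLaw hg0 hpow hmono h1 (m := 18) (by norm_num)
    simpa using this
  have h1782 : (1782 : ℝ) ^ θ ≤ g 1782 := by
    have := rpow_logb_le_of_powLaw hg0 hpow hmono h1 (m := 1782) (by norm_num)
    simpa using this
  -- rational certificates
  have hu4 : 4 ≤ (8 : ℝ) ^ θ := by
    have e : (8 : ℝ) ^ ((2 : ℝ) / 3) = 4 := by
      rw [show (8 : ℝ) = 2 ^ (3 : ℕ) by norm_num, ← Real.rpow_natCast (2 : ℝ) 3,
        ← Real.rpow_mul (by norm_num : (0:ℝ) ≤ 2)]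
      norm_num
    rw [← e]
    exact Real.rpow_le_rpow_of_exponent_le (by norm_num) hθ23
  have hu8 : (8 : ℝ) ^ θ ≤ 8 := by
    have := Real.rpow_le_rpow_of_exponent_le (by norm_num : (1:ℝ) ≤ 8) hθ1
    simpa using this
  have cert₁ : (1.717 : ℝ) ≤ (9 / 4 : ℝ) ^ θ := by
    have f1 : (9 / 4 : ℝ) ^ ((2 : ℝ) / 3) ≤ (9 / 4 : ℝ) ^ θ :=
      Real.rpow_le_rpow_of_exponent_le (by norm_num) hθ23
    have f2 : (1.717 : ℝ) ≤ (9 / 4 : ℝ) ^ ((2 : ℝ) / 3) := by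
      rw [show (2 : ℝ) / 3 = (2 : ℝ) * ((3 : ℕ) : ℝ)⁻¹ by norm_num, Real.rpow_mul (by norm_num),
        Real.rpow_two,
        show (1.717 : ℝ) = ((1.717 : ℝ) ^ 3) ^ ((3 : ℕ)⁻¹ : ℝ) from
          (Real.pow_rpow_inv_natCast (by norm_num) three_ne_zero).symm]
      exact Real.rpow_le_rpow (by norm_num) (by norm_num) (by norm_num)
    exact f2.trans f1
  have cert₂ : (36.74 : ℝ) ≤ (891 / 4 : ℝ) ^ θ := by
    have f1 : (891 / 4 : ℝ) ^ ((2 : ℝ) / 3) ≤ (891 / 4 : ℝ) ^ θ :=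
      Real.rpow_le_rpow_of_exponent_le (by norm_num) hθ23
    have f2 : (36.74 : ℝ) ≤ (891 / 4 : ℝ) ^ ((2 : ℝ) / 3) := by
      rw [show (2 : ℝ) / 3 = (2 : ℝ) * ((3 : ℕ) : ℝ)⁻¹ by norm_num, Real.rpow_mul (by norm_num),
        Real.rpow_two,
        show (36.74 : ℝ) = ((36.74 : ℝ) ^ 3) ^ ((3 : ℕ)⁻¹ : ℝ) from
          (Real.pow_rpow_inv_natCast (by norm_num) three_ne_zero).symm]
      exact Real.rpow_le_rpow (by norm_num) (by norm_num) (by norm_num)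
    exact f2.trans f1
  have e18 : (18 : ℝ) ^ θ = (9 / 4 : ℝ) ^ θ * (8 : ℝ) ^ θ := by
    rw [← Real.mul_rpow (by norm_num) (by norm_num)]; norm_num
  have e1782 : (1782 : ℝ) ^ θ = (891 / 4 : ℝ) ^ θ * (8 : ℝ) ^ θ := by
    rw [← Real.mul_rpow (by norm_num) (by norm_num)]; norm_num
  set u := (8 : ℝ) ^ θ with hu
  have hu0 : 0 ≤ u := by linarith
  have hc1 : 1.717 * u ≤ g 18 := by
    have : 1.717 * u ≤ (9 / 4 : ℝ) ^ θ * u := mul_le_mul_of_nonneg_right cert₁ hu0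
    linarith [h18, e18]
  have hc2 : 36.74 * u ≤ g 1782 := by
    have : 36.74 * u ≤ (891 / 4 : ℝ) ^ θ * u := mul_le_mul_of_nonneg_right cert₂ hu0
    linarith [h1782, e1782]
  rw [h8] at hid
  -- contradiction above the threshold
  by_contra hXB
  push Not at hXB
  have e1 : 2 * X * (1.717 * u) ≤ 2 * X * g 18 := mul_le_mul_of_nonneg_left hc1 (by linarith)
  have e3 : ((3.9235 : ℝ) ^ 3) ^ 2 < X ^ 2 := by gcongr
  have e4 : (3.9235 : ℝ) ^ 3 * u ≤ X * u := mul_le_mul_of_nonneg_right hXB.le hu0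
  have e5 : 0 ≤ (u - 4) * (8 - u) := mul_nonneg (by linarith) (by linarith)
  nlinarith [e1, e3, e4, e5, hid, hc2, hu4]

/-- **The `n = 4` evaluation** (the paper's Table 1 entry `γ'_2 = 3.931`): with `θ ∈ [2/3,1]` as
above and `X² + 2 X g(110) + g(25222) ≤ (256 + g 16)²`, `X ≤ 3.9309⁴` (exact supremum
`238.7565…`, fourth root `3.930871…`). Certificates: `16^θ ∈ [6.3496, 16]` (`6.3496³ ≤ 16²`),
`110^θ ≥ 3.615·16^θ` (`3.615³ ≤ (55/8)²`), `25222^θ ≥ 135.44·16^θ` (`135.44³ ≤ (12611/8)²`). -/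
theorem iteratedSpeedup_numeric_four {g : ℕ → ℝ} (hg0 : ∀ m, 0 ≤ g m)
    (hpow : ∀ a L : ℕ, g (a ^ L) = g a ^ L) (hmono : ∀ a b : ℕ, a ≤ b → g a ≤ g b)
    (h2 : g 2 ≤ 2) (h4 : 4 ≤ g 2 ^ 3) {X : ℝ}
    (hid : X ^ 2 + 2 * X * g 110 + g 25222 ≤ (4 ^ 4 + g 16) ^ 2) : X ≤ 3.9309 ^ 4 := by
  have hg2 := hg0 2
  have hsq : g 2 ^ 2 ≤ 4 := by nlinarith
  have h1 : 1 ≤ g 2 := by nlinarith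
  set θ := Real.logb 2 (g 2) with hθ
  have hc : (2 : ℝ) ^ θ = g 2 := Real.rpow_logb (by norm_num) (by norm_num) (by linarith)
  have pw : ∀ j : ℕ, ((2 : ℝ) ^ j) ^ θ = g 2 ^ j := fun j => by
    rw [← Real.rpow_natCast (2 : ℝ) j, ← Real.rpow_mul (by norm_num : (0:ℝ) ≤ 2), mul_comm,
      Real.rpow_mul (by norm_num : (0:ℝ) ≤ 2), hc, Real.rpow_natCast]
  have hθ23 : 2 / 3 ≤ θ := by
    have h : (2 : ℝ) ^ (2 : ℝ) ≤ (2 : ℝ) ^ (θ * 3) := by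
      rw [Real.rpow_mul (by norm_num : (0:ℝ) ≤ 2), hc, Real.rpow_two,
        show (3 : ℝ) = ((3 : ℕ) : ℝ) by norm_num, Real.rpow_natCast]
      linarith
    have := (Real.rpow_le_rpow_left_iff one_lt_two).1 h
    linarith
  have hθ1 : θ ≤ 1 := by
    have h : (2 : ℝ) ^ θ ≤ (2 : ℝ) ^ (1 : ℝ) := by rw [hc, Real.rpow_one]; exact h2
    exact (Real.rpow_le_rpow_left_iff one_lt_two).1 h
  have h16 : g 16 = (16 : ℝ) ^ θ := by
    rw [show (16 : ℕ) = 2 ^ 4 by norm_num, hpow, ← pw 4]; norm_num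
  have h110 : (110 : ℝ) ^ θ ≤ g 110 := by
    have := rpow_logb_le_of_powLaw hg0 hpow hmono h1 (m := 110) (by norm_num)
    simpa using this
  have h25222 : (25222 : ℝ) ^ θ ≤ g 25222 := by
    have := rpow_logb_le_of_powLaw hg0 hpow hmono h1 (m := 25222) (by norm_num)
    simpa using this
  have hulo : (6.3496 : ℝ) ≤ (16 : ℝ) ^ θ := by
    have f1 : (16 : ℝ) ^ ((2 : ℝ) / 3) ≤ (16 : ℝ) ^ θ :=
      Real.rpow_le_rpow_of_exponent_le (by norm_num) hθ23
    have f2 : (6.3496 : ℝ) ≤ (16 : ℝ) ^ ((2 : ℝ) / 3) := by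
      rw [show (2 : ℝ) / 3 = (2 : ℝ) * ((3 : ℕ) : ℝ)⁻¹ by norm_num, Real.rpow_mul (by norm_num),
        Real.rpow_two,
        show (6.3496 : ℝ) = ((6.3496 : ℝ) ^ 3) ^ ((3 : ℕ)⁻¹ : ℝ) from
          (Real.pow_rpow_inv_natCast (by norm_num) three_ne_zero).symm]
      exact Real.rpow_le_rpow (by norm_num) (by norm_num) (by norm_num)
    exact f2.trans f1
  have huhi : (16 : ℝ) ^ θ ≤ 16 := by
    have := Real.rpow_le_rpow_of_exponent_le (by norm_num : (1:ℝ) ≤ 16) hθ1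
    simpa using this
  have cert₁ : (3.615 : ℝ) ≤ (55 / 8 : ℝ) ^ θ := by
    have f1 : (55 / 8 : ℝ) ^ ((2 : ℝ) / 3) ≤ (55 / 8 : ℝ) ^ θ :=
      Real.rpow_le_rpow_of_exponent_le (by norm_num) hθ23
    have f2 : (3.615 : ℝ) ≤ (55 / 8 : ℝ) ^ ((2 : ℝ) / 3) := by
      rw [show (2 : ℝ) / 3 = (2 : ℝ) * ((3 : ℕ) : ℝ)⁻¹ by norm_num, Real.rpow_mul (by norm_num),
        Real.rpow_two,
        show (3.615 : ℝ) = ((3.615 : ℝ) ^ 3) ^ ((3 : ℕ)⁻¹ : ℝ) from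
          (Real.pow_rpow_inv_natCast (by norm_num) three_ne_zero).symm]
      exact Real.rpow_le_rpow (by norm_num) (by norm_num) (by norm_num)
    exact f2.trans f1
  have cert₂ : (135.44 : ℝ) ≤ (12611 / 8 : ℝ) ^ θ := by
    have f1 : (12611 / 8 : ℝ) ^ ((2 : ℝ) / 3) ≤ (12611 / 8 : ℝ) ^ θ :=
      Real.rpow_le_rpow_of_exponent_le (by norm_num) hθ23
    have f2 : (135.44 : ℝ) ≤ (12611 / 8 : ℝ) ^ ((2 : ℝ) / 3) := by
      rw [show (2 : ℝ) / 3 = (2 : ℝ) * ((3 : ℕ) : ℝ)⁻¹ by norm_num, Real.rpow_mul (by norm_num),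
        Real.rpow_two,
        show (135.44 : ℝ) = ((135.44 : ℝ) ^ 3) ^ ((3 : ℕ)⁻¹ : ℝ) from
          (Real.pow_rpow_inv_natCast (by norm_num) three_ne_zero).symm]
      exact Real.rpow_le_rpow (by norm_num) (by norm_num) (by norm_num)
    exact f2.trans f1
  have e110 : (110 : ℝ) ^ θ = (55 / 8 : ℝ) ^ θ * (16 : ℝ) ^ θ := by
    rw [← Real.mul_rpow (by norm_num) (by norm_num)]; norm_num
  have e25222 : (25222 : ℝ) ^ θ = (12611 / 8 : ℝ) ^ θ * (16 : ℝ) ^ θ := by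
    rw [← Real.mul_rpow (by norm_num) (by norm_num)]; norm_num
  set u := (16 : ℝ) ^ θ with hu
  have hu0 : 0 ≤ u := by linarith
  have hc1 : 3.615 * u ≤ g 110 := by
    have : 3.615 * u ≤ (55 / 8 : ℝ) ^ θ * u := mul_le_mul_of_nonneg_right cert₁ hu0
    linarith [h110, e110]
  have hc2 : 135.44 * u ≤ g 25222 := by
    have : 135.44 * u ≤ (12611 / 8 : ℝ) ^ θ * u := mul_le_mul_of_nonneg_right cert₂ hu0
    linarith [h25222, e25222]
  rw [h16] at hid
  by_contra hXB
  push Not at hXB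
  have e1 : 2 * X * (3.615 * u) ≤ 2 * X * g 110 := mul_le_mul_of_nonneg_left hc1 (by linarith)
  have e3 : ((3.9309 : ℝ) ^ 4) ^ 2 < X ^ 2 := by gcongr
  have e4 : (3.9309 : ℝ) ^ 4 * u ≤ X * u := mul_le_mul_of_nonneg_right hXB.le hu0
  have e5 : 0 ≤ (u - 6.3496) * (16 - u) := mul_nonneg (by linarith) (by linarith)
  nlinarith [e1, e3, e4, e5, hid, hc2, hulo]

end Real

/-! ## The bounds -/

section Main

/-- **Every universal spectral point has `F(cw₂) ≤ 3.9235`, given the Alman–Li iterated identity**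
(evaluated at `n = 3`: `t = 18`, `t² + 2·3⁶ = 1782`). -/
theorem spectralPoint_cwTensor_two_le_of_iteratedSpeedup (hAL : AlmanLi2026_iteratedSpeedup_cw)
    {F : SpectralMap ℂ} (hF : IsUniversalSpectralPoint ℂ F) : F (cwTensor ℂ 2) ≤ 3.9235 := by
  rw [← pow_le_pow_iff_left₀ (hF.nonneg _) (by norm_num) three_ne_zero]
  refine pow_spectralPoint_cwTensor_two_le_of_iteratedSpeedup hAL hF (n := 3) (t := 18) (by norm_num)
    (by norm_num) (by norm_num) ?_
  intro g hg0 hpow hmono h2 h4 X _ hid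
  have e1 : (18 : ℕ) ^ 2 + 2 * 3 ^ (2 * 3) = 1782 := by norm_num
  have e2 : (2 : ℕ) ^ 3 = 8 := by norm_num
  rw [e1, e2] at hid
  exact iteratedSpeedup_numeric_three hg0 hpow hmono h2 h4 hid

/-- **The paper's own evaluation, reproduced: `F(cw₂) ≤ 3.9309` from the identity at `n = 4`**
(`t = 110`, `t² + 2·3⁸ = 25222`; arXiv:2605.21738 Table 1, `γ'_2 = 3.931`). -/
theorem spectralPoint_cwTensor_two_le_of_iteratedSpeedup_four (hAL : AlmanLi2026_iteratedSpeedup_cw)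
    {F : SpectralMap ℂ} (hF : IsUniversalSpectralPoint ℂ F) : F (cwTensor ℂ 2) ≤ 3.9309 := by
  rw [← pow_le_pow_iff_left₀ (hF.nonneg _) (by norm_num) four_ne_zero]
  refine pow_spectralPoint_cwTensor_two_le_of_iteratedSpeedup hAL hF (n := 4) (t := 110) (by norm_num)
    (by norm_num) (by norm_num) ?_
  intro g hg0 hpow hmono h2 h4 X _ hid
  have e1 : (110 : ℕ) ^ 2 + 2 * 3 ^ (2 * 4) = 25222 := by norm_num
  have e2 : (2 : ℕ) ^ 4 = 16 := by norm_num
  rw [e1, e2] at hid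
  exact iteratedSpeedup_numeric_four hg0 hpow hmono h2 h4 hid

/-- **`R̃(cw₂) ≤ 3.9235` from the Alman–Li iterated identity at `n = 3`** (Strassen duality, proved
in the tree, turns the pointwise bound into the asymptotic-rank bound). -/
theorem asymptoticRank_cwTensor_two_le_of_iteratedSpeedup (hAL : AlmanLi2026_iteratedSpeedup_cw) :
    asymptoticRank (cwTensor ℂ 2) ≤ 3.9235 := by
  obtain ⟨F, hF, hFt⟩ := (strassen_duality_asymptoticRank_holds ℂ (cwTensor ℂ 2)).2
  rw [← hFt]
  exact spectralPoint_cwTensor_two_le_of_iteratedSpeedup hAL hF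

/-- The paper's value, reproduced in the kernel: `R̃(cw₂) ≤ 3.9309` from the identity at `n = 4`. -/
theorem asymptoticRank_cwTensor_two_le_of_iteratedSpeedup_four (hAL : AlmanLi2026_iteratedSpeedup_cw) :
    asymptoticRank (cwTensor ℂ 2) ≤ 3.9309 := by
  obtain ⟨F, hF, hFt⟩ := (strassen_duality_asymptoticRank_holds ℂ (cwTensor ℂ 2)).2
  rw [← hFt]
  exact spectralPoint_cwTensor_two_le_of_iteratedSpeedup_four hAL hF

end Main

end Summit.MatrixMultiplication.MatrixMultiplication.Theorems

end
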